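import Summits.Parity.GeneralizedHardyLittlewood.Theorems.FordMaynardNoSieveConst0164NegWitness0164LinnikFour

/-!
# Route `FordMaynardNoSieveConst0164`, crux `NegWitness0164` (stmt-Parity-19102), line `birth`,
# stub `stub_tweakNeg0164`: disjoint-union convolutions on a quadruple

Tenth helper file toward the certificate stub (K. Ford, J. Maynard, *On the theory of prime producing
sieves*, arXiv:2407.14368, (Linnik-fcn) §5.1: `𝓛_c(x) = ∑_j ((−1)^{j+1}/j) N^{⋆j}(x)`).  The five- and
six-piece Linnik weights of the certificate (`h(1) = … + S₅ + S₆`, helper file `…KOne`; Ford–Maynard §8: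
"if `x ∈ 𝓗₅` with every pair of components having sum less than `1/2` then `𝓛_{1/2}(x) = −6`") are
computed from the convolution powers `N^{⋆j}` of the small-subvector indicator `N` on the subsets of
`Fin 5`, `Fin 6`; this file supplies the generic values on a QUADRUPLE `{a, b, c, d}` of distinct elements
(for a set function `F` with `F ∅ = 0` and, where needed, `F = 1` on singletons):

* `sum_powerset_quad'`, `sconv_quad` — the sixteen-subset expansions;
* `spow_two_quad = 2 ∑_{triples} F + 2 ∑_{matchings} F(p)F(p')`, `spow_three_quad = 6 ∑_{pairs} F`,
  `spow_four_quad = 24`, `spow_five_quad = 0`;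
* `spow_four_singleton = spow_four_pair = spow_four_triple = 0`.

(The singleton/pair/triple values of `F⋆F` and `F^{⋆3}` are in `…LinnikFour`.)  Def-free.

References: [FordMaynard2024PrimeSieves] arXiv:2407.14368, (Linnik-fcn) §5.1, §8.
-/

noncomputable section

open Finset
open Literature.Combinatorics.Enumerative

namespace Summit.Parity.GeneralizedHardyLittlewood.FordMaynardNoSieveConst0164NegWitness0164

variable {α : Type*} [DecidableEq α]

/-- Sums over the sixteen subsets of a quadruple of distinct elements. [folklore] -/
theorem sum_powerset_quad' {a b c d : α} (hab : a ≠ b) (hac : a ≠ c) (had : a ≠ d) (hbc : b ≠ c)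
    (hbd : b ≠ d) (hcd : c ≠ d) (φ : Finset α → ℝ) :
    ∑ T ∈ ({a, b, c, d} : Finset α).powerset, φ T =
      φ ∅ + φ {a} + φ {b} + φ {c} + φ {d} + φ {a, b} + φ {a, c} + φ {a, d} + φ {b, c} + φ {b, d} +
        φ {c, d} + φ {a, b, c} + φ {a, b, d} + φ {a, c, d} + φ {b, c, d} + φ {a, b, c, d} := by
  rw [Finset.sum_powerset_insert (by simp [hab, hac, had]), sum_powerset_triple' hbc hbd hcd,
    sum_powerset_triple' hbc hbd hcd, show insert a (∅ : Finset α) = {a} from rfl]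
  ring

/-- `(F ⋆ G)` at a quadruple `{a, b, c, d}` of distinct elements, expanded over the sixteen subsets.
[folklore] -/
theorem sconv_quad (F G : Finset α → ℝ) {a b c d : α} (hab : a ≠ b) (hac : a ≠ c) (had : a ≠ d)
    (hbc : b ≠ c) (hbd : b ≠ d) (hcd : c ≠ d) :
    sconv F G {a, b, c, d} =
      F ∅ * G {a, b, c, d} + F {a} * G {b, c, d} + F {b} * G {a, c, d} + F {c} * G {a, b, d} +
        F {d} * G {a, b, c} + F {a, b} * G {c, d} + F {a, c} * G {b, d} + F {a, d} * G {b, c} +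
        F {b, c} * G {a, d} + F {b, d} * G {a, c} + F {c, d} * G {a, b} + F {a, b, c} * G {d} +
        F {a, b, d} * G {c} + F {a, c, d} * G {b} + F {b, c, d} * G {a} + F {a, b, c, d} * G ∅ := by
  unfold sconv
  rw [sum_powerset_quad' hab hac had hbc hbd hcd]
  have e1 : ({a, b, c, d} : Finset α) \ {a} = {b, c, d} := by
    ext x; simp only [Finset.mem_sdiff, Finset.mem_insert, Finset.mem_singleton]; aesop
  have e2 : ({a, b, c, d} : Finset α) \ {b} = {a, c, d} := by
    ext x; simp only [Finset.mem_sdiff, Finset.mem_insert, Finset.mem_singleton]; aesop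
  have e3 : ({a, b, c, d} : Finset α) \ {c} = {a, b, d} := by
    ext x; simp only [Finset.mem_sdiff, Finset.mem_insert, Finset.mem_singleton]; aesop
  have e4 : ({a, b, c, d} : Finset α) \ {d} = {a, b, c} := by
    ext x; simp only [Finset.mem_sdiff, Finset.mem_insert, Finset.mem_singleton]; aesop
  have e5 : ({a, b, c, d} : Finset α) \ {a, b} = {c, d} := by
    ext x; simp only [Finset.mem_sdiff, Finset.mem_insert, Finset.mem_singleton]; aesop
  have e6 : ({a, b, c, d} : Finset α) \ {a, c} = {b, d} := by
    ext x; simp only [Finset.mem_sdiff, Finset.mem_insert, Finset.mem_singleton]; aesop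
  have e7 : ({a, b, c, d} : Finset α) \ {a, d} = {b, c} := by
    ext x; simp only [Finset.mem_sdiff, Finset.mem_insert, Finset.mem_singleton]; aesop
  have e8 : ({a, b, c, d} : Finset α) \ {b, c} = {a, d} := by
    ext x; simp only [Finset.mem_sdiff, Finset.mem_insert, Finset.mem_singleton]; aesop
  have e9 : ({a, b, c, d} : Finset α) \ {b, d} = {a, c} := by
    ext x; simp only [Finset.mem_sdiff, Finset.mem_insert, Finset.mem_singleton]; aesop
  have e10 : ({a, b, c, d} : Finset α) \ {c, d} = {a, b} := by
    ext x; simp only [Finset.mem_sdiff, Finset.mem_insert, Finset.mem_singleton]; aesop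
  have e11 : ({a, b, c, d} : Finset α) \ {a, b, c} = {d} := by
    ext x; simp only [Finset.mem_sdiff, Finset.mem_insert, Finset.mem_singleton]; aesop
  have e12 : ({a, b, c, d} : Finset α) \ {a, b, d} = {c} := by
    ext x; simp only [Finset.mem_sdiff, Finset.mem_insert, Finset.mem_singleton]; aesop
  have e13 : ({a, b, c, d} : Finset α) \ {a, c, d} = {b} := by
    ext x; simp only [Finset.mem_sdiff, Finset.mem_insert, Finset.mem_singleton]; aesop
  have e14 : ({a, b, c, d} : Finset α) \ {b, c, d} = {a} := by
    ext x; simp only [Finset.mem_sdiff, Finset.mem_insert, Finset.mem_singleton]; aesop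
  rw [Finset.sdiff_empty, e1, e2, e3, e4, e5, e6, e7, e8, e9, e10, e11, e12, e13, e14, Finset.sdiff_self]

/-! ### Convolution powers on a quadruple -/

section Quad

variable {F : Finset α → ℝ} (h0 : F ∅ = 0) {a b c d : α} (hab : a ≠ b) (hac : a ≠ c) (had : a ≠ d)
  (hbc : b ≠ c) (hbd : b ≠ d) (hcd : c ≠ d)
include h0 hab hac had hbc hbd hcd

/-- `F⋆F` at a quadruple (`F ∅ = 0`, `F = 1` on singletons): `2 ∑_{triples} F + 2 ∑_{matchings} F(p)F(p')`
(splits `1+3`, `3+1` and `2+2`). [folklore] -/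
theorem spow_two_quad (ha : F {a} = 1) (hb : F {b} = 1) (hc : F {c} = 1) (hd : F {d} = 1) :
    spow F 2 {a, b, c, d} =
      2 * (F {b, c, d} + F {a, c, d} + F {a, b, d} + F {a, b, c}) +
        2 * (F {a, b} * F {c, d} + F {a, c} * F {b, d} + F {a, d} * F {b, c}) := by
  rw [spow_succ, spow_succ, spow_zero, sconv_sdelta, sconv_quad F F hab hac had hbc hbd hcd, h0, ha, hb,
    hc, hd]
  ring

/-- `F^{⋆3}` at a quadruple (`F ∅ = 0`, `F = 1` on singletons): `6 ∑_{pairs} F` (one pair and two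
singletons, in `3!` orders). [folklore] -/
theorem spow_three_quad (ha : F {a} = 1) (hb : F {b} = 1) (hc : F {c} = 1) (hd : F {d} = 1) :
    spow F 3 {a, b, c, d} =
      6 * (F {a, b} + F {a, c} + F {a, d} + F {b, c} + F {b, d} + F {c, d}) := by
  rw [spow_succ, sconv_quad F _ hab hac had hbc hbd hcd, h0, ha, hb, hc, hd,
    spow_two_triple h0 hbc hbd hcd hb hc hd, spow_two_triple h0 hac had hcd ha hc hd,
    spow_two_triple h0 hab had hbd ha hb hd, spow_two_triple h0 hab hac hbc ha hb hc,
    spow_two_pair h0 hcd hc hd, spow_two_pair h0 hbd hb hd, spow_two_pair h0 hbc hb hc,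
    spow_two_pair h0 had ha hd, spow_two_pair h0 hac ha hc, spow_two_pair h0 hab ha hb,
    spow_two_singleton h0, spow_two_singleton h0, spow_two_singleton h0, spow_two_singleton h0,
    spow_succ_empty h0]
  ring

/-- `F^{⋆4}` at a quadruple (`F ∅ = 0`, `F = 1` on singletons): `4! = 24`. [folklore] -/
theorem spow_four_quad (ha : F {a} = 1) (hb : F {b} = 1) (hc : F {c} = 1) (hd : F {d} = 1) :
    spow F 4 {a, b, c, d} = 24 := by
  rw [spow_succ, sconv_quad F _ hab hac had hbc hbd hcd, h0, ha, hb, hc, hd,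
    spow_three_triple h0 hbc hbd hcd hb hc hd, spow_three_triple h0 hac had hcd ha hc hd,
    spow_three_triple h0 hab had hbd ha hb hd, spow_three_triple h0 hab hac hbc ha hb hc,
    spow_three_pair h0 hcd, spow_three_pair h0 hbd, spow_three_pair h0 hbc, spow_three_pair h0 had,
    spow_three_pair h0 hac, spow_three_pair h0 hab,
    spow_three_singleton h0, spow_three_singleton h0, spow_three_singleton h0, spow_three_singleton h0,
    spow_succ_empty h0]
  ring

end Quad

/-- `F^{⋆4}({a}) = 0` when `F ∅ = 0`. [folklore] -/
theorem spow_four_singleton {F : Finset α → ℝ} (h0 : F ∅ = 0) (a : α) : spow F 4 {a} = 0 := by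
  rw [spow_succ, sconv_singleton, h0, spow_succ_empty h0]; ring

/-- `F^{⋆4}({a, b}) = 0` when `F ∅ = 0` (`a ≠ b`). [folklore] -/
theorem spow_four_pair {F : Finset α → ℝ} (h0 : F ∅ = 0) {a b : α} (hab : a ≠ b) :
    spow F 4 {a, b} = 0 := by
  rw [spow_succ, sconv_pair F _ hab, h0, spow_three_singleton h0, spow_three_singleton h0,
    spow_succ_empty h0]; ring

/-- `F^{⋆4}({a, b, c}) = 0` when `F ∅ = 0` (`a, b, c` distinct): a triple has no decomposition into four
nonempty parts. [folklore] -/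
theorem spow_four_triple {F : Finset α → ℝ} (h0 : F ∅ = 0) {a b c : α} (hab : a ≠ b) (hac : a ≠ c)
    (hbc : b ≠ c) : spow F 4 {a, b, c} = 0 := by
  rw [spow_succ, sconv_triple F _ hab hac hbc, h0, spow_three_pair h0 hbc, spow_three_pair h0 hac,
    spow_three_pair h0 hab, spow_three_singleton h0, spow_three_singleton h0, spow_three_singleton h0,
    spow_succ_empty h0]
  ring

/-- `F^{⋆5}` at a quadruple vanishes (`F ∅ = 0`; `a, b, c, d` distinct). [folklore] -/
theorem spow_five_quad {F : Finset α → ℝ} (h0 : F ∅ = 0) {a b c d : α} (hab : a ≠ b) (hac : a ≠ c)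
    (had : a ≠ d) (hbc : b ≠ c) (hbd : b ≠ d) (hcd : c ≠ d) : spow F 5 {a, b, c, d} = 0 := by
  rw [spow_succ, sconv_quad F _ hab hac had hbc hbd hcd, h0,
    spow_four_triple h0 hbc hbd hcd, spow_four_triple h0 hac had hcd, spow_four_triple h0 hab had hbd,
    spow_four_triple h0 hab hac hbc, spow_four_pair h0 hcd, spow_four_pair h0 hbd, spow_four_pair h0 hbc,
    spow_four_pair h0 had, spow_four_pair h0 hac, spow_four_pair h0 hab,
    spow_four_singleton h0, spow_four_singleton h0, spow_four_singleton h0, spow_four_singleton h0,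
    spow_succ_empty h0]
  ring

end Summit.Parity.GeneralizedHardyLittlewood.FordMaynardNoSieveConst0164NegWitness0164

end
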